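import Summits.AtomisticToContinuum.Crystallization.Theses.MinMeanCycleStackingLock
import Summits.AtomisticToContinuum.Crystallization.Theses.PoissonBesselStacking
import Summits.AtomisticToContinuum.Crystallization.Theses.LuttingerTiszaRegistry
import Summits.AtomisticToContinuum.Crystallization.Theorems.PhononSlackCertificatesPeriodicGivenLayeredClosing2
import Summits.AtomisticToContinuum.Crystallization.Theorems.PhononSlackCertificatesPeriodicGivenLayeredRegistry
import Summits.AtomisticToContinuum.Crystallization.Theorems.PhononSlackCertificatesPeriodicGivenLayeredLayerCake

/-!
# Line `layered-seam` — crux `MinMeanCycleStackingLock.PeriodicReductionToBarlow`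
(item `stmt-AtomisticToContinuum-3062`, shared with `PoissonBesselStacking` / `LuttingerTiszaRegistry`;
crux-strategist gen 1, 2026-08-17).

THE CUT.  The crux ("every periodic configuration `Q` of `ℝ³` is matched, at no higher Lennard-Jones
energy per particle, by a UNIFORM Barlow stacking with parameters in the box
`B = {47/50 ≤ a ≤ 1, 39a/50 ≤ h ≤ 17a/20}`") is cut along the LAYERED class of the sibling hub item
`LayeredWindows` (stmt-11778): triangular layers of spacing `a ∈ [47/50, 1]`, consecutive layers in hole
registry along an ARBITRARY Hägg word `s`, ARBITRARY interlayer spacings `z (m+1) − z m ∈ [39a/50, 17a/20]`.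
For such layered data the full site energy of a point of layer `m` is the layer cake
`Φ₀(a) + T_s(m)`, `Φ₀ = inLayerInteraction lennardJones a`,
`T_s(m) = Σ'_{m' ≠ m} layerInteraction lennardJones a (z m' − z m) (haggLabel s m' − haggLabel s m) 1`
(the format of the LANDED `LayeredHull.stub_layerCake`, clause 3), and the energy per particle of a
`p`-periodic layered stacking is `(2p)⁻¹ Σ_{m<p} (Φ₀ + T_s(m))`.

* `stub_periodicLayeringInBox` (HARDEST, the 3-D content, open): every periodic `Q` is matched at no
  higher LJ energy per particle by SOME `p`-periodic layered stacking in the box — word and spacings FREE.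
  This is strictly less than the crux asks (no stacking selection, no spacing uniformisation) and strictly
  less than the birth line's `stub_reductionToBarlowFree` (which wants a UNIFORM stacking, at uncertified
  free parameters); it is the periodic shadow of `LayeredWindows` and is implied by it through landed
  theorems (see the line card, §Transfer), but not conversely.
* `restackAlternating` (word side, PROVED HERE — it was `stub_restackAlternating` in v1 of this file): at the
  SAME heights, the alternating word `ABAB…` has layer energy `≤` that of any Hägg word, layer by layer — the
  `c₀ = 0` shadow of the LANDED per-layer fault price `LayeredHull.clo_layer_price` fed with the LANDED
  certified registry facts `LayeredHull.stub_registry` (D_a ≤ 0, non-decreasing on `[39a/25, ∞)`) and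
  `LayeredHull.stub_layerCake` (decay + summability); fifteen lines.
* `stub_uniformBarlowFloor` (spacing side + identification, provable now): for the alternating word with
  `p`-periodic increments in the box there is ONE spacing `h ∈ [39a/50, 17a/20]` (the mean increment) with
  `2p · e(hcp a h) ≤ Σ_{m<p} (Φ₀ + T_alt(m))` — Jensen (Cauchy induction, rational weights `1/p`, no
  continuity needed) on the LANDED certified midpoint convexity `LayeredHull.stub_convexity` of the
  alternating block energies, block ↔ period bookkeeping by the LANDED `LayeredHull.clo_block_decomposition`,
  and the LANDED identification `BarlowEnergyIdentification` (item 3065) + `barlowSiteEnergy_eq` /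
  `tsum_layer_above/below` for the uniform stack.  Size M.

Assembly `PeriodicReductionToBarlow_of`: chain the three comparisons and divide by `2p > 0`; the witness is
`(a, h̄, alternatingHagg, period 2) ∈ B`.  Sorry-free; concludes the route decl BY NAME (and the two shared
copies by definitional unfolding).  TWO stubs remain textually (`stub_periodicLayeringInBox`, `stub_uniformBarlowFloor`); the second is PROVED in
`../LayeredSeamReduction.lean` (v3, this seat), which also proves the reduction theorem
`LayeredSeam.PeriodicReductionToBarlow_of_periodicLayeringInBox : (stub 1) → crux` outright — so the open content of this line
is exactly `stub_periodicLayeringInBox`.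
No stub restates the crux, the summit, or a refuted statement
(negatives 4146 / 3506 / 15929 / 17253 concern tolerance-quantified local structure, not energy comparisons
of layered data).
-/

noncomputable section

namespace Summit.AtomisticToContinuum.Crystallization.Cruxes.PeriodicReductionToBarlow.LayeredSeam

open Literature.MathematicalPhysics.StatisticalMechanics
open Summit.AtomisticToContinuum.Crystallization.Theorems.LayeredHull

/-- **Stub 1 (HARDEST) — periodic layering in the box.**  Every periodic configuration of `ℝ³` is matched,
at no higher Lennard-Jones energy per particle, by a `p`-periodic LAYERED stacking: triangular layers of
spacing `a ∈ [47/50, 1]` in hole registry along a `p`-periodic Hägg word `s`, heights `z` with `p`-periodic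
increments in `[39a/50, 17a/20]`; its energy per particle is `(2p)⁻¹ Σ_{m<p} (Φ₀(a) + T_s(m))`. Open (the
periodic form of the layering half of the crystal problem, Blanc–Lewin 2015 §2.3). -/
theorem stub_periodicLayeringInBox :
    ∀ Q : Literature.MathematicalPhysics.StatisticalMechanics.PeriodicConfiguration 3,
      ∃ (a : ℝ) (s : ℤ → ℤ) (z : ℤ → ℝ) (p : ℕ), 0 < p ∧ 47 / 50 ≤ a ∧ a ≤ 1 ∧
        Literature.MathematicalPhysics.StatisticalMechanics.IsHaggSeq s ∧ (∀ m : ℤ, s (m + p) = s m) ∧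
        (∀ m : ℤ, z (m + p + 1) - z (m + p) = z (m + 1) - z m) ∧
        (∀ m : ℤ, 39 / 50 * a ≤ z (m + 1) - z m ∧ z (m + 1) - z m ≤ 17 / 20 * a) ∧
        (∑ m ∈ Finset.range p,
            (Literature.MathematicalPhysics.StatisticalMechanics.inLayerInteraction
                Literature.MathematicalPhysics.StatisticalMechanics.lennardJones a +
              ∑' m' : ℤ, if m' = (m : ℤ) then (0 : ℝ) else
                Literature.MathematicalPhysics.StatisticalMechanics.layerInteraction
                  Literature.MathematicalPhysics.StatisticalMechanics.lennardJones a (z m' - z m)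
                  (Literature.MathematicalPhysics.StatisticalMechanics.haggLabel s m' -
                    Literature.MathematicalPhysics.StatisticalMechanics.haggLabel s m) 1)) ≤
          2 * (p : ℝ) * Q.energyPerParticle Literature.MathematicalPhysics.StatisticalMechanics.lennardJones := by
  sorry

/-- **Word side (was stub 2, now PROVED) — restacking to the alternating word at the same heights never
raises a layer energy.**  For `a ∈ [47/50, 1]`, any Hägg word `s`, any heights `z` with increments in
`[39a/50, 17a/20]` and every layer `m`: `T_alt(m) ≤ T_s(m)`.  The `c₀ = 0` shadow of the landed
`LayeredHull.clo_layer_price`, whose hypotheses are discharged by the landed certified `LayeredHull.stub_registry`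
and by `LayeredHull.stub_layerCake` (decay; summability via its clause 2 with `A = id`). [folklore] -/
theorem restackAlternating :
    ∀ a : ℝ, 47 / 50 ≤ a → a ≤ 1 → ∀ (s : ℤ → ℤ) (z : ℤ → ℝ),
      Literature.MathematicalPhysics.StatisticalMechanics.IsHaggSeq s →
      (∀ m : ℤ, 39 / 50 * a ≤ z (m + 1) - z m ∧ z (m + 1) - z m ≤ 17 / 20 * a) →
      ∀ m : ℤ,
        (∑' m' : ℤ, if m' = m then (0 : ℝ) else
            Literature.MathematicalPhysics.StatisticalMechanics.layerInteraction
              Literature.MathematicalPhysics.StatisticalMechanics.lennardJones a (z m' - z m)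
              (Literature.MathematicalPhysics.StatisticalMechanics.haggLabel
                  Literature.MathematicalPhysics.StatisticalMechanics.alternatingHagg m' -
                Literature.MathematicalPhysics.StatisticalMechanics.haggLabel
                  Literature.MathematicalPhysics.StatisticalMechanics.alternatingHagg m) 1) ≤
        (∑' m' : ℤ, if m' = m then (0 : ℝ) else
            Literature.MathematicalPhysics.StatisticalMechanics.layerInteraction
              Literature.MathematicalPhysics.StatisticalMechanics.lennardJones a (z m' - z m)
              (Literature.MathematicalPhysics.StatisticalMechanics.haggLabel s m' -
                Literature.MathematicalPhysics.StatisticalMechanics.haggLabel s m) 1) := by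
  intro a ha ha1 s z hs hz m
  obtain ⟨c₀, hc₀, hreg⟩ := stub_registry
  obtain ⟨hreg1, hreg2⟩ := hreg a ha ha1
  obtain ⟨C, hcake⟩ := stub_layerCake
  obtain ⟨hdecay, hrest⟩ := hcake a ha ha1
  have hS := hrest (LinearIsometry.id : EuclideanSpace ℝ (Fin 3) →ₗᵢ[ℝ] EuclideanSpace ℝ (Fin 3)) s z hs hz
  have hA := hrest (LinearIsometry.id : EuclideanSpace ℝ (Fin 3) →ₗᵢ[ℝ] EuclideanSpace ℝ (Fin 3))
    alternatingHagg z isHaggSeq_alternating hz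
  have key := clo_layer_price ha hs hz hdecay hreg1 hreg2 m (hS.2.1 m) (hA.2.1 m)
  have h0 : (0 : ℝ) ≤ c₀ * (if s (m + 1) = -s m then (0 : ℝ) else 1) := by
    have : (0 : ℝ) ≤ (if s (m + 1) = -s m then (0 : ℝ) else 1) := by split_ifs <;> norm_num
    exact mul_nonneg hc₀.le this
  linarith

/-- **Stub 3 — uniform Barlow floor for the alternating word (spacing uniformisation + identification).**
**PROVED (v3)**: `LayeredSeam.uniformBarlowFloor` in the crux workfile `../LayeredSeamReduction.lean` (rc 0, 0 sorries, standard
axioms) — kept here as a `sorry` stub only so that the registered cut of this skeleton is unchanged; it closes by landing that file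
verbatim under `Theorems/` (`--supports stmt-AtomisticToContinuum-3062`) and citing the theorem.
For `a ∈ [47/50, 1]` and heights `z` with `p`-periodic increments in `[39a/50, 17a/20]` (`p > 0`) there is a
spacing `h ∈ [39a/50, 17a/20]` such that the hcp-type uniform stacking `barlowPeriodicConfiguration
alternatingHagg` at `(a, h)` satisfies `2p · e ≤ Σ_{m<p} (Φ₀(a) + T_alt(m))`.  Jensen on the landed
certified `LayeredHull.stub_convexity` + `LayeredHull.clo_block_decomposition` + the landed
`BarlowEnergyIdentification` (item 3065). -/
theorem stub_uniformBarlowFloor :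
    ∀ a : ℝ, 47 / 50 ≤ a → a ≤ 1 → ∀ (z : ℤ → ℝ) (p : ℕ), 0 < p →
      (∀ m : ℤ, z (m + p + 1) - z (m + p) = z (m + 1) - z m) →
      (∀ m : ℤ, 39 / 50 * a ≤ z (m + 1) - z m ∧ z (m + 1) - z m ≤ 17 / 20 * a) →
      ∃ h : ℝ, 39 / 50 * a ≤ h ∧ h ≤ 17 / 20 * a ∧ ∃ (ha : a ≠ 0) (hh : h ≠ 0),
        2 * (p : ℝ) *
            (Literature.MathematicalPhysics.StatisticalMechanics.barlowPeriodicConfiguration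
                Literature.MathematicalPhysics.StatisticalMechanics.alternatingHagg ha hh (two_ne_zero)
                Literature.MathematicalPhysics.StatisticalMechanics.alternatingHagg_periodic).energyPerParticle
              Literature.MathematicalPhysics.StatisticalMechanics.lennardJones ≤
          ∑ m ∈ Finset.range p,
            (Literature.MathematicalPhysics.StatisticalMechanics.inLayerInteraction
                Literature.MathematicalPhysics.StatisticalMechanics.lennardJones a +
              ∑' m' : ℤ, if m' = (m : ℤ) then (0 : ℝ) else
                Literature.MathematicalPhysics.StatisticalMechanics.layerInteraction
                  Literature.MathematicalPhysics.StatisticalMechanics.lennardJones a (z m' - z m)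
                  (Literature.MathematicalPhysics.StatisticalMechanics.haggLabel
                      Literature.MathematicalPhysics.StatisticalMechanics.alternatingHagg m' -
                    Literature.MathematicalPhysics.StatisticalMechanics.haggLabel
                      Literature.MathematicalPhysics.StatisticalMechanics.alternatingHagg m) 1) := by
  sorry

/-! ## Assembly -/

/-- **Assembly**: stub 1 → stub 2 → stub 3 → the crux.  Given `Q`, take the layered competitor of stub 1,
restack it to the alternating word layer by layer (stub 2), uniformise its spacings and identify the result
with `barlowPeriodicConfiguration alternatingHagg` at `(a, h̄) ∈ B` (stub 3); divide by `2p > 0`.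
Concludes `MinMeanCycleStackingLock.PeriodicReductionToBarlow` BY NAME; no `sorry`. -/
theorem PeriodicReductionToBarlow_of
    (hLayer : ∀ Q : Literature.MathematicalPhysics.StatisticalMechanics.PeriodicConfiguration 3,
      ∃ (a : ℝ) (s : ℤ → ℤ) (z : ℤ → ℝ) (p : ℕ), 0 < p ∧ 47 / 50 ≤ a ∧ a ≤ 1 ∧
        Literature.MathematicalPhysics.StatisticalMechanics.IsHaggSeq s ∧ (∀ m : ℤ, s (m + p) = s m) ∧
        (∀ m : ℤ, z (m + p + 1) - z (m + p) = z (m + 1) - z m) ∧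
        (∀ m : ℤ, 39 / 50 * a ≤ z (m + 1) - z m ∧ z (m + 1) - z m ≤ 17 / 20 * a) ∧
        (∑ m ∈ Finset.range p,
            (Literature.MathematicalPhysics.StatisticalMechanics.inLayerInteraction
                Literature.MathematicalPhysics.StatisticalMechanics.lennardJones a +
              ∑' m' : ℤ, if m' = (m : ℤ) then (0 : ℝ) else
                Literature.MathematicalPhysics.StatisticalMechanics.layerInteraction
                  Literature.MathematicalPhysics.StatisticalMechanics.lennardJones a (z m' - z m)
                  (Literature.MathematicalPhysics.StatisticalMechanics.haggLabel s m' -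
                    Literature.MathematicalPhysics.StatisticalMechanics.haggLabel s m) 1)) ≤
          2 * (p : ℝ) * Q.energyPerParticle Literature.MathematicalPhysics.StatisticalMechanics.lennardJones)
    (hRestack : ∀ a : ℝ, 47 / 50 ≤ a → a ≤ 1 → ∀ (s : ℤ → ℤ) (z : ℤ → ℝ),
      Literature.MathematicalPhysics.StatisticalMechanics.IsHaggSeq s →
      (∀ m : ℤ, 39 / 50 * a ≤ z (m + 1) - z m ∧ z (m + 1) - z m ≤ 17 / 20 * a) →
      ∀ m : ℤ,
        (∑' m' : ℤ, if m' = m then (0 : ℝ) else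
            Literature.MathematicalPhysics.StatisticalMechanics.layerInteraction
              Literature.MathematicalPhysics.StatisticalMechanics.lennardJones a (z m' - z m)
              (Literature.MathematicalPhysics.StatisticalMechanics.haggLabel
                  Literature.MathematicalPhysics.StatisticalMechanics.alternatingHagg m' -
                Literature.MathematicalPhysics.StatisticalMechanics.haggLabel
                  Literature.MathematicalPhysics.StatisticalMechanics.alternatingHagg m) 1) ≤
        (∑' m' : ℤ, if m' = m then (0 : ℝ) else
            Literature.MathematicalPhysics.StatisticalMechanics.layerInteraction
              Literature.MathematicalPhysics.StatisticalMechanics.lennardJones a (z m' - z m)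
              (Literature.MathematicalPhysics.StatisticalMechanics.haggLabel s m' -
                Literature.MathematicalPhysics.StatisticalMechanics.haggLabel s m) 1))
    (hFloor : ∀ a : ℝ, 47 / 50 ≤ a → a ≤ 1 → ∀ (z : ℤ → ℝ) (p : ℕ), 0 < p →
      (∀ m : ℤ, z (m + p + 1) - z (m + p) = z (m + 1) - z m) →
      (∀ m : ℤ, 39 / 50 * a ≤ z (m + 1) - z m ∧ z (m + 1) - z m ≤ 17 / 20 * a) →
      ∃ h : ℝ, 39 / 50 * a ≤ h ∧ h ≤ 17 / 20 * a ∧ ∃ (ha : a ≠ 0) (hh : h ≠ 0),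
        2 * (p : ℝ) *
            (Literature.MathematicalPhysics.StatisticalMechanics.barlowPeriodicConfiguration
                Literature.MathematicalPhysics.StatisticalMechanics.alternatingHagg ha hh (two_ne_zero)
                Literature.MathematicalPhysics.StatisticalMechanics.alternatingHagg_periodic).energyPerParticle
              Literature.MathematicalPhysics.StatisticalMechanics.lennardJones ≤
          ∑ m ∈ Finset.range p,
            (Literature.MathematicalPhysics.StatisticalMechanics.inLayerInteraction
                Literature.MathematicalPhysics.StatisticalMechanics.lennardJones a +
              ∑' m' : ℤ, if m' = (m : ℤ) then (0 : ℝ) else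
                Literature.MathematicalPhysics.StatisticalMechanics.layerInteraction
                  Literature.MathematicalPhysics.StatisticalMechanics.lennardJones a (z m' - z m)
                  (Literature.MathematicalPhysics.StatisticalMechanics.haggLabel
                      Literature.MathematicalPhysics.StatisticalMechanics.alternatingHagg m' -
                    Literature.MathematicalPhysics.StatisticalMechanics.haggLabel
                      Literature.MathematicalPhysics.StatisticalMechanics.alternatingHagg m) 1)) :
    Summit.AtomisticToContinuum.Crystallization.Theses.MinMeanCycleStackingLock.PeriodicReductionToBarlow := by
  intro Q
  obtain ⟨a, s, z, p, hp, ha₁, ha₂, hs, _hsp, hzp, hz, hE⟩ := hLayer Q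
  obtain ⟨h, hh₁, hh₂, ha, hh, hfloor⟩ := hFloor a ha₁ ha₂ z p hp hzp hz
  -- restacking, summed over a period
  have hsum :
      (∑ m ∈ Finset.range p,
          (Literature.MathematicalPhysics.StatisticalMechanics.inLayerInteraction
              Literature.MathematicalPhysics.StatisticalMechanics.lennardJones a +
            ∑' m' : ℤ, if m' = (m : ℤ) then (0 : ℝ) else
              Literature.MathematicalPhysics.StatisticalMechanics.layerInteraction
                Literature.MathematicalPhysics.StatisticalMechanics.lennardJones a (z m' - z m)
                (Literature.MathematicalPhysics.StatisticalMechanics.haggLabel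
                    Literature.MathematicalPhysics.StatisticalMechanics.alternatingHagg m' -
                  Literature.MathematicalPhysics.StatisticalMechanics.haggLabel
                    Literature.MathematicalPhysics.StatisticalMechanics.alternatingHagg m) 1)) ≤
      ∑ m ∈ Finset.range p,
          (Literature.MathematicalPhysics.StatisticalMechanics.inLayerInteraction
              Literature.MathematicalPhysics.StatisticalMechanics.lennardJones a +
            ∑' m' : ℤ, if m' = (m : ℤ) then (0 : ℝ) else
              Literature.MathematicalPhysics.StatisticalMechanics.layerInteraction
                Literature.MathematicalPhysics.StatisticalMechanics.lennardJones a (z m' - z m)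
                (Literature.MathematicalPhysics.StatisticalMechanics.haggLabel s m' -
                  Literature.MathematicalPhysics.StatisticalMechanics.haggLabel s m) 1) := by
    refine Finset.sum_le_sum fun m _ => ?_
    exact add_le_add le_rfl (hRestack a ha₁ ha₂ s z hs hz (m : ℤ))
  have hchain := (hfloor.trans hsum).trans hE
  have hp' : (0 : ℝ) < 2 * (p : ℝ) := by positivity
  have hle :
      (Literature.MathematicalPhysics.StatisticalMechanics.barlowPeriodicConfiguration
          Literature.MathematicalPhysics.StatisticalMechanics.alternatingHagg ha hh (two_ne_zero)
          Literature.MathematicalPhysics.StatisticalMechanics.alternatingHagg_periodic).energyPerParticle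
        Literature.MathematicalPhysics.StatisticalMechanics.lennardJones ≤
      Q.energyPerParticle Literature.MathematicalPhysics.StatisticalMechanics.lennardJones :=
    le_of_mul_le_mul_left hchain hp'
  refine ⟨a, h, ha₁, ha₂, hh₁, hh₂, Literature.MathematicalPhysics.StatisticalMechanics.alternatingHagg, 2,
    ha, hh, two_ne_zero, Literature.MathematicalPhysics.StatisticalMechanics.alternatingHagg_periodic,
    Literature.MathematicalPhysics.StatisticalMechanics.isHaggSeq_alternating, hle⟩

/-- The assembly instantiated with the two stubs and the proved word-side lemma: the crux, modulo exactly the two `sorry`s. -/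
theorem PeriodicReductionToBarlow_skeleton :
    Summit.AtomisticToContinuum.Crystallization.Theses.MinMeanCycleStackingLock.PeriodicReductionToBarlow :=
  PeriodicReductionToBarlow_of stub_periodicLayeringInBox restackAlternating stub_uniformBarlowFloor

/-! ### The shared copies of the crux (identical signatures; definitional unfolding) -/

/-- The `PoissonBesselStacking` copy of the shared item 3062, modulo the two stubs. -/
theorem PeriodicReductionToBarlow_proofPBS :
    Summit.AtomisticToContinuum.Crystallization.Theses.PoissonBesselStacking.PeriodicReductionToBarlow :=
  PeriodicReductionToBarlow_of stub_periodicLayeringInBox restackAlternating stub_uniformBarlowFloor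

/-- The `LuttingerTiszaRegistry` copy of the shared item 3062, modulo the two stubs. -/
theorem PeriodicReductionToBarlow_proofLT :
    Summit.AtomisticToContinuum.Crystallization.Theses.LuttingerTiszaRegistry.PeriodicReductionToBarlow :=
  PeriodicReductionToBarlow_of stub_periodicLayeringInBox restackAlternating stub_uniformBarlowFloor

end Summit.AtomisticToContinuum.Crystallization.Cruxes.PeriodicReductionToBarlow.LayeredSeam

end
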